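import Summits.QuantumFields.BalabanUV.T4Continuum.Support.NE7AxialChartCube
import Summits.QuantumFields.BalabanUV.T4Continuum.Support.NE7LatticeLandauMinimiser
import Summits.QuantumFields.BalabanUV.T4Continuum.Support.NE7GradientCurrency
import Summits.QuantumFields.BalabanUV.T4Continuum.Support.NE3EnergyShapes
import HarnessLib

/-!
# NE7AxialChartTorus — THE LOCAL CHART ON THE TORUS FROM PLAQUETTE DATA: a PERIODIC unitary gauge `u` and a PERIODIC skew potential `At` with GLOBAL sup and
# gradient letters and `U^{u} = e^{At}` on the torus ball `torusSupNorm (y − z) ≤ R′ − M_w`, for every periodic unitary `U` with plaquette radius `x` and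
# covariant plaquette-gradient radius `x₁` (the shape of the `hchart` binder of row NE7's wide-cover ENDs)

Cell `pub-balaban`, rung (B)+1 sub-cell t4, lineage `b2b-balaban-t4-ne7-p1` (CRUX PROVER NE7 #1 = OWNER of row NE7), generation 91; memo
`t4/b2b-balaban-t4-ne7-p1-g91/COVER-OBSTRUCTION.md` §3.  Over F290a `NE7AxialChartCube.exists_axialChart_cube` (the cut-off logarithm of the axial gauge on a cube of
`ℤ^{d+1}`) and the torus bookkeeping of the tree (`SkeletonLattice.cmod`, `NE7LatticeLandauMinimiser.cmod_add_zsmul`, `AveragingDeficitTorusChart.periodic_smul_vec`).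

WHY.  The `hchart` binder of `NE7HintOfLocalChartSU2Wide.hint_of_localChart_SU2_wide` (F286w) asks, for a periodic `U`, a PERIODIC unitary site gauge `u`, a PERIODIC skew
`At` bounded with its lattice gradient EVERYWHERE, and `gaugeAct u U = vary flat At 1` on a torus ball about `z`.  F290a gives the cube version on `ℤ^{d+1}`; this
file periodises it through the centred representative `c(y) = z − h𝟙 + ((y − z + h𝟙) mod P)`, `h = R′ + 1`: `u(y) := U(Γ_{base, c(y)})` (the axial tree transport at
the representative), `At(y) := A(c(y))`.  On the ball the representative does not cross the seam (`c(y + e_κ) = c(y) + e_κ`), so `U^{u}(y) = W₀(c(y)) = e^{A(c(y))}`;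
across the seam both values of `A` vanish (the support of `A` is the cube of radius `R′ < h`), so the gradient letter survives periodisation.  Needs `2R′ + 4 ≤ P`.
WHAT ([folklore]; 0 def, 0 sorry; dimension `d + 1`).  §1 integer bookkeeping of the representative (`emod` of a shift; periodicity, congruence, centring, the seam
dichotomy).  §2 **`exists_periodic_chart`**: the seven-clause conclusion of the `hchart` binder (unitary periodic `u`, skew periodic `At`, `‖At‖ ≤ 4(d+1)(R′+1)x`,
`‖At(y+e_τ,κ) − At(y,κ)‖ ≤ (4∕3)g₁ + 4(d+1)(R′+1)x∕M_w`, agreement on `torusSupNorm (y − z) ≤ R′ − M_w`) from `SmallField U x`, the all-directions covariant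
plaquette-gradient radius `x₁`, `2(d+1)(R′+1)x ≤ 1∕4` and `2R′ + 4 ≤ P`.

HONEST FRAMING (page 1): kinematics + torus bookkeeping; the datum `x₁` is a HYPOTHESIS ([Balaban1985Variational] Thm 1 (9)–(10) TYPE for the tangent-critical
minimiser, NOT proved); THE CHART is thereby REDUCED to that datum, not proved; (APE) and NE7 NOT proved; nothing of Bałaban's asserted; spine 0∕9; finite T⁴ rung
(B)+1 — NOT infinite volume, NOT mass gap, NOT `BetaPertH`, NOT Clay.  Continuum YM on T⁴ ⇐ BetaPertH ∧ nine spine estimates (0/9 proved); BetaPertH ⇐ (D1) ∧ (D4) ∧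
CAP+tail; G-an2-4 gates asym, D1 and NE2/3/4.  No `sorry`; axioms ⊆ {propext, Classical.choice, Quot.sound}.  PLACEMENT: our lemma, under `Summits/QuantumFields/BalabanUV/`.
-/

set_option autoImplicit false

open scoped BigOperators Matrix Matrix.Norms.L2Operator
open NormedSpace Finset

namespace Summit.QuantumFields.BalabanUV.T4Continuum.NE7AxialChartTorus

open Literature.MathematicalPhysics.QuantumFieldTheory.Balaban1983to89
open B7Prop1Explicit B7Prop2Explicit MatrixLog
open B4TorusKernel.MultiPeriod (torusSupNorm circAbs)
open T4AveragingDeficitWall (Ad IsUnitaryCfg IsSkewDir SmallField vary)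
open T4AveragingDeficitWallBoundary (IsPeriodicCfg)
open AveragingDeficitPeriodicCounting (IsPeriodicDir)
open AveragingDeficitTorusChart (periodic_smul_vec)
open NE3EnergyShapes (IsUnitarySite)
open BlockAveragePushDirSplit (flat)
open NE7GradientCurrency (vary_flat_one_apply)
open SkeletonLattice (cmod cdiv smul_cdiv_add_cmod cmod_nonneg cmod_lt)
open NE7LatticeLandauMinimiser (cmod_add_zsmul)
open NE7AxialChartCube (exists_axialChart_cube)

noncomputable section

variable {d : ℕ} {n : Type*} [Fintype n] [DecidableEq n]

/-! ## §1 Integer bookkeeping of the centred representative -/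

/-- `(P·q + b) mod P = b` for `0 ≤ b < P`. [folklore] -/
theorem emod_of_repr {P : ℤ} {q b : ℤ} (hb0 : 0 ≤ b) (hbP : b < P) : (P * q + b) % P = b := by
  rw [show P * q + b = b + P * q by ring, Int.add_mul_emod_self_left]
  exact Int.emod_eq_of_lt hb0 hbP

/-- The centred remainder: for `circAbs P v ≤ R_b` and `R_b ≤ h`, `h + R_b + 1 ≤ P`, one has `|(v + h) mod P − h| ≤ R_b`. [folklore] -/
theorem abs_cen_le {P : ℕ} (hP : 1 ≤ P) {Rb h : ℕ} (hRh : Rb ≤ h) (hhP : h + Rb + 1 ≤ P) (v : ℤ) (hv : circAbs P v ≤ (Rb : ℤ)) :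
    |(v + (h : ℤ)) % (P : ℤ) - (h : ℤ)| ≤ (Rb : ℤ) := by
  have hP0 : (0 : ℤ) < (P : ℤ) := by exact_mod_cast hP
  set a : ℤ := v % (P : ℤ) with ha
  have ha0 : 0 ≤ a := Int.emod_nonneg _ hP0.ne'
  have haP : a < (P : ℤ) := Int.emod_lt_of_pos _ hP0
  have hva : v = (P : ℤ) * (v / (P : ℤ)) + a := by rw [ha]; exact (Int.mul_ediv_add_emod v (P : ℤ)).symm
  have hmin : circAbs P v = min a ((P : ℤ) - a) := rfl
  rw [hmin] at hv
  by_cases hc : a + h < (P : ℤ)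
  · -- no wrap: the remainder is `a + h`
    have h1 : (v + (h : ℤ)) % (P : ℤ) = a + h := by
      rw [hva, show (P : ℤ) * (v / (P : ℤ)) + a + (h : ℤ) = (P : ℤ) * (v / (P : ℤ)) + (a + h) by ring]
      exact emod_of_repr (by positivity) hc
    rw [h1, show a + (h : ℤ) - h = a by ring, abs_of_nonneg ha0]
    rcases min_le_iff.mp hv with h2 | h2
    · exact h2
    · exfalso
      have : (P : ℤ) - (Rb : ℤ) ≤ a := by linarith
      have h3 : ((h + Rb + 1 : ℕ) : ℤ) ≤ (P : ℤ) := by exact_mod_cast hhP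
      push_cast at h3
      linarith
  · -- wrap: the remainder is `a + h − P`
    push Not at hc
    have h1 : (v + (h : ℤ)) % (P : ℤ) = a + h - P := by
      rw [hva, show (P : ℤ) * (v / (P : ℤ)) + a + (h : ℤ) = (P : ℤ) * (v / (P : ℤ) + 1) + (a + h - P) by ring]
      exact emod_of_repr (by linarith) (by linarith)
    rw [h1, show a + (h : ℤ) - P - h = -((P : ℤ) - a) by ring, abs_neg, abs_of_nonneg (by linarith)]
    rcases min_le_iff.mp hv with h2 | h2
    · exfalso
      have h3 : ((h + Rb + 1 : ℕ) : ℤ) ≤ (P : ℤ) := by exact_mod_cast hhP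
      have h4 : ((Rb : ℕ) : ℤ) ≤ (h : ℤ) := by exact_mod_cast hRh
      push_cast at h3
      linarith
    · exact h2

/-- The seam dichotomy for one more step: with `r = (v + h) mod P`, either `r + 1 < P` and `(v + 1 + h) mod P = r + 1`, or `r = P − 1` and
`(v + 1 + h) mod P = 0`. [folklore] -/
theorem emod_succ_dichotomy {P : ℕ} (hP : 2 ≤ P) (v h : ℤ) :
    ((v + h) % (P : ℤ) + 1 < (P : ℤ) ∧ (v + 1 + h) % (P : ℤ) = (v + h) % (P : ℤ) + 1) ∨
    ((v + h) % (P : ℤ) = (P : ℤ) - 1 ∧ (v + 1 + h) % (P : ℤ) = 0) := by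
  have hP0 : (0 : ℤ) < (P : ℤ) := by exact_mod_cast (by omega : 0 < P)
  set r : ℤ := (v + h) % (P : ℤ) with hr
  have hr0 : 0 ≤ r := Int.emod_nonneg _ hP0.ne'
  have hrP : r < (P : ℤ) := Int.emod_lt_of_pos _ hP0
  have hrepr : v + 1 + h = (P : ℤ) * ((v + h) / (P : ℤ)) + (r + 1) := by
    have := Int.mul_ediv_add_emod (v + h) (P : ℤ)
    rw [hr]; linarith
  by_cases hc : r + 1 < (P : ℤ)
  · left
    exact ⟨hc, by rw [hrepr]; exact emod_of_repr (by linarith) hc⟩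
  · right
    push Not at hc
    have hreq : r = (P : ℤ) - 1 := by linarith
    refine ⟨hreq, ?_⟩
    rw [hrepr, hreq, show (P : ℤ) * ((v + h) / (P : ℤ)) + ((P : ℤ) - 1 + 1) = (P : ℤ) * ((v + h) / (P : ℤ) + 1) + 0 by ring]
    exact emod_of_repr le_rfl hP0

/-! ## §2 The periodic chart -/

set_option maxHeartbeats 800000 in
/-- **THE LOCAL CHART ON THE TORUS FROM PLAQUETTE DATA.**  For a unitary `P`-periodic `U` on `ℤ^{d+1}` with `SmallField U x`, covariant plaquette gradients `≤ x₁` in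
every direction, a centre `z`, radii `1 ≤ M_w ≤ R′` with `2R′ + 4 ≤ P` and `2(d+1)(R′+1)x ≤ 1∕4`: there are a unitary `P`-periodic site gauge `u` and a skew
`P`-periodic `At` with `‖At(y, κ)‖ ≤ 4(d+1)(R′+1)x`, `‖At(y + e_τ, κ) − At(y, κ)‖ ≤ (4∕3)(2(d+1)(R′+2)x₁ + 16(d+1)²(R′+2)²x² + 2x) + 4(d+1)(R′+1)x∕M_w` for ALL
`y, κ, τ`, and `U^{u}(y, κ) = (vary flat At 1)(y, κ)` whenever `torusSupNorm (y − z) ≤ R′ − M_w`. [folklore] -/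
theorem exists_periodic_chart [Nonempty n] {U : Site (d + 1) → Fin (d + 1) → (Matrix n n ℂ)ˣ} (hUu : IsUnitaryCfg U) {P : ℕ}
    (hUP : IsPeriodicCfg U (P : ℤ)) {x x₁ : ℝ} (hx0 : 0 ≤ x) (hx10 : 0 ≤ x₁) (hUx : SmallField U x)
    (hgrad : ∀ (p : Site (d + 1)) (τ μ κ : Fin (d + 1)), κ ≠ μ →
      ‖Ad (U p τ) ((hol U (p + e τ) (plaqWord κ μ) : (Matrix n n ℂ)ˣ) : Matrix n n ℂ) - ((hol U p (plaqWord κ μ) : (Matrix n n ℂ)ˣ) : Matrix n n ℂ)‖ ≤ x₁)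
    (z : Site (d + 1)) (R' Mw : ℕ) (hMw : 1 ≤ Mw) (hMwR : Mw ≤ R') (hPR : 2 * R' + 4 ≤ P) (hs : 2 * ((d : ℝ) + 1) * ((R' : ℝ) + 1) * x ≤ 1 / 4) :
    ∃ (u : Site (d + 1) → (Matrix n n ℂ)ˣ) (At : Site (d + 1) → Fin (d + 1) → Matrix n n ℂ),
      IsUnitarySite u ∧ (∀ (y : Site (d + 1)) (i : Fin (d + 1)), u (y + (P : ℤ) • e i) = u y) ∧
      IsSkewDir At ∧ IsPeriodicDir At (P : ℤ) ∧
      (∀ (y : Site (d + 1)) (κ : Fin (d + 1)), ‖At y κ‖ ≤ 4 * ((d : ℝ) + 1) * ((R' : ℝ) + 1) * x) ∧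
      (∀ (y : Site (d + 1)) (κ τ : Fin (d + 1)), ‖At (y + e τ) κ - At y κ‖
        ≤ 4 / 3 * (2 * ((d : ℝ) + 1) * ((R' : ℝ) + 2) * x₁ + 16 * ((d : ℝ) + 1) ^ 2 * ((R' : ℝ) + 2) ^ 2 * x ^ 2 + 2 * x)
          + 4 * ((d : ℝ) + 1) * ((R' : ℝ) + 1) * x / Mw) ∧
      (∀ (y : Site (d + 1)) (κ : Fin (d + 1)), torusSupNorm (fun _ : Fin (d + 1) => P) (y - z) ≤ ((R' - Mw : ℕ) : ℝ) →
        gaugeAct u U y κ = vary (flat (d := d + 1) (n := n)) At 1 y κ) := by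
  -- the cube chart
  obtain ⟨A, hAskew, hAsupp, hAsup, hAgrad, hAexp⟩ := exists_axialChart_cube (d := d) hUu hx0 hx10 hUx hgrad z R' Mw hMw hMwR hs
  -- the centred representative `c y = z − h𝟙 + ((y − z + h𝟙) mod P)`, `h = R′ + 1`
  have hP1 : 1 ≤ P := by omega
  have hP2 : 2 ≤ P := by omega
  set h : ℕ := R' + 1 with hh
  set hv : Site (d + 1) := fun _ => (h : ℤ) with hhv
  set c : Site (d + 1) → Site (d + 1) := fun y => cmod P (y - z + hv) + (z - hv) with hc
  have hc_apply : ∀ (y : Site (d + 1)) (j : Fin (d + 1)), c y j = (y j - z j + (h : ℤ)) % (P : ℤ) + (z j - (h : ℤ)) := fun y j => rfl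
  -- periodicity of the representative
  have hc_per : ∀ (y : Site (d + 1)) (i : Fin (d + 1)), c (y + (P : ℤ) • e i) = c y := fun y i => by
    simp only [hc]
    rw [show y + (P : ℤ) • e i - z + hv = (y - z + hv) + (P : ℤ) • e i by abel, cmod_add_zsmul hP1]
  -- congruence: `c y = y + P • m`
  have hc_cong : ∀ y : Site (d + 1), c y = y + (P : ℤ) • (-cdiv P (y - z + hv)) := fun y => by
    have h1 := smul_cdiv_add_cmod P (y - z + hv)
    simp only [hc]
    rw [smul_neg, ← sub_eq_add_neg, eq_sub_iff_add_eq]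
    calc cmod P (y - z + hv) + (z - hv) + (P : ℤ) • cdiv P (y - z + hv) = ((P : ℤ) • cdiv P (y - z + hv) + cmod P (y - z + hv)) + (z - hv) := by abel
      _ = y := by rw [h1]; abel
  have hU_c : ∀ (y : Site (d + 1)) (κ : Fin (d + 1)), U (c y) κ = U y κ := fun y κ => by
    rw [hc_cong y]
    exact congrFun (periodic_smul_vec (f := fun w => U w) (N := (P : ℤ)) (fun w i => funext fun μ => hUP w i μ) y _) κ
  -- on the ball the representative is centred and does not meet the seam
  have hball : ∀ y : Site (d + 1), torusSupNorm (fun _ : Fin (d + 1) => P) (y - z) ≤ ((R' - Mw : ℕ) : ℝ) →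
      ∀ j, |c y j - z j| ≤ (R' : ℤ) - Mw := fun y hy j => by
    have h1 : (circAbs P ((y - z) j) : ℝ) ≤ ((R' - Mw : ℕ) : ℝ) := by
      refine le_trans ?_ hy
      unfold torusSupNorm
      exact Finset.le_sup' (fun i => ((circAbs P ((y - z) i) : ℤ) : ℝ)) (Finset.mem_univ j)
    have h2 : circAbs P ((y - z) j) ≤ ((R' - Mw : ℕ) : ℤ) := by exact_mod_cast h1
    have h3 := abs_cen_le hP1 (Rb := R' - Mw) (h := h) (by omega) (by omega) ((y - z) j) h2
    rw [hc_apply, show (y j - z j + (h : ℤ)) % (P : ℤ) + (z j - (h : ℤ)) - z j = (y j - z j + (h : ℤ)) % (P : ℤ) - (h : ℤ) by ring]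
    have h4 : ((R' - Mw : ℕ) : ℤ) = (R' : ℤ) - Mw := by push_cast [Nat.cast_sub hMwR]; ring
    rw [← h4]
    simpa [Pi.sub_apply] using h3
  have hstep : ∀ (y : Site (d + 1)) (τ : Fin (d + 1)),
      c (y + e τ) = c y + e τ ∨ ((R' : ℤ) < |c y τ - z τ| ∧ (R' : ℤ) < |c (y + e τ) τ - z τ|) := fun y τ => by
    rcases emod_succ_dichotomy hP2 (y τ - z τ) (h : ℤ) with ⟨_, hr2⟩ | ⟨hr1, hr2⟩
    · left
      funext j
      rw [Pi.add_apply, hc_apply, hc_apply, Pi.add_apply, e_apply]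
      split_ifs with hj
      · rw [hj, show y τ + 1 - z τ + (h : ℤ) = y τ - z τ + 1 + (h : ℤ) by ring, hr2]; ring
      · simp
    · right
      have hP' : ((2 * R' + 4 : ℕ) : ℤ) ≤ (P : ℤ) := by exact_mod_cast hPR
      push_cast at hP'
      constructor
      · rw [hc_apply, hr1, show (P : ℤ) - 1 + (z τ - (h : ℤ)) - z τ = (P : ℤ) - 1 - (h : ℤ) by ring, hh]
        push_cast
        rw [abs_of_nonneg (by linarith)]
        linarith
      · rw [hc_apply, Pi.add_apply, e_apply, if_pos rfl, show y τ + 1 - z τ + (h : ℤ) = y τ - z τ + 1 + (h : ℤ) by ring, hr2, hh]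
        push_cast
        rw [show (0 : ℤ) + (z τ - ((R' : ℤ) + 1)) - z τ = -((R' : ℤ) + 1) by ring, abs_neg, abs_of_nonneg (by positivity)]
        linarith
  -- the gauge and the potential
  set base : Site (d + 1) := z - fun _ => (R' : ℤ) + 1 with hbase
  refine ⟨fun y => axialFn U base (c y), fun y κ => A (c y) κ, ?_, ?_, ?_, ?_, ?_, ?_, ?_⟩
  · -- unitary
    intro y
    exact hol_mem_of (S := unitaryUnits (Matrix n n ℂ)) hUu _ _
  · -- periodic gauge
    intro y i
    simp only [hc_per]
  · -- skew
    intro y κ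
    exact hAskew _ _
  · -- periodic potential
    intro y i μ
    simp only [hc_per]
  · -- sup
    intro y κ
    exact hAsup _ _
  · -- gradient
    intro y κ τ
    rcases hstep y τ with h1 | ⟨h1, h2⟩
    · simp only [h1]
      exact hAgrad _ _ _
    · have e1 : A (c y) κ = 0 := hAsupp _ _ ⟨τ, h1⟩
      have e2 : A (c (y + e τ)) κ = 0 := hAsupp _ _ ⟨τ, h2⟩
      simp only [e1, e2, sub_zero, norm_zero]
      positivity
  · -- agreement on the ball
    intro y κ hy
    have hyb := hball y hy
    have hstep' : c (y + e κ) = c y + e κ := by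
      rcases hstep y κ with h1 | ⟨h1, _⟩
      · exact h1
      · exfalso
        have := hyb κ
        have hMw' : (0 : ℤ) ≤ Mw := by positivity
        linarith
    apply Units.ext
    rw [vary_flat_one_apply, val_expUnit, hAexp (c y) κ hyb]
    simp only [gaugeAct, hstep', hU_c]

end

end Summit.QuantumFields.BalabanUV.T4Continuum.NE7AxialChartTorus
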